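import Summits.CriticalPhenomena.SAWScalingLimit.Theorems.SAWDevelopingMapHexTightReversalDefs
import Summits.CriticalPhenomena.SAWScalingLimit.Theorems.HexTight.Negative.RingDomain

/-!
# (crux workfile copy) `OneScaleDive` off criticality — the four proposal parts
`Theorems/HexTight/Negative/OneScaleDive{Chains,Arcs,Disc,Subcritical}.lean` concatenated (sections), published here so the
lead can read/import the content before the proposals land. drefute gen 2, 2026-08-16.
-/

/-!
# `OneScaleDive` off criticality: the one-scale dive bound FAILS at small fugacity
(negative lemma for crux `HexTight`, stmt-CriticalPhenomena-5423, line `reversal-virgin-disc`, stub 2)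

drefute generation 2 (refuter, 2026-08-16). The line `reversal-virgin-disc`
(`Cruxes/HexTight/Lines/reversal-virgin-disc.lean`) rests on the atom `stub_oneScaleDive`:
uniformly over virgin configurations, the `x_c`-weighted arcs between two doors on the circle of radius
`N` that DIVE to radius `N/2` carry at most a fraction `q < 1` of the arc mass. Here the same statement is
written at a general fugacity `x` (`OneScaleDiveAt x`; at `x = x_c` it is the stub VERBATIM,
`oneScaleDiveAt_critical_iff`, by `Iff.rfl` over the landed objects of
`Theorems/SAWDevelopingMapHexTightReversalDefs.lean`) and REFUTED for `0 ≤ x ≤ 1/500`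
(`not_oneScaleDiveAt_of_le`): in the blocked lattice disc `Λ_M = {v : ‖c(v)‖ ≤ N_M}`,
`N_M = ‖c(U(M,0))‖ = √((M+½)² + 1/12)`, with the two antipodal doors on the real axis, the straight
zigzag `U(M,0), D(M-1,0), U(M-1,0), …, U(-M-1,0)` (`4M+3` cells) dives, whereas every NON-diving arc has
at least `5M+3` cells (it must pass a cell `P` with `Re c(P) = 0`, hence `|Im c(P)| > N_M/2`; the lattice
potentials `3cA ∓ cB` (`cA = 2 Re c`, `cB = (6/√3) Im c`) drop by `≤ 4` per step and `≤ 6` per TWO steps), and there are at most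
`3^{n-1}` arcs with `n` cells from a given door; so `(1-q)·x^{4M+3} ≤ q·(3x)^{5M+3}/(1-3x)`, false for
large `M` once `243·x < 1/2`.

WHAT THE PROVERS SHOULD TAKE FROM IT. The dive ratio of the line is NOT monotone in the fugacity and is
`< 1` ONLY at criticality: for `x < x_c` the chord between antipodal doors concentrates on lattice
geodesics, which pass through the centre (here: rigorously for `x ≤ 1/500`; heuristically for every
`x < x_c` by the exponential decay of the subcritical two-point function, Madras–Slade 1993 ch. 4), and for
`x > x_c` the walk is space-filling (Duminil-Copin–Kozma–Yadin, Ann. Probab. 42 (2014)). Hence no proof of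
`stub_oneScaleDive` (nor of the milestone `BulkOneArmDecay`, whose level `m = 1` is the dive bound:
`not_bulkOneArmDecayAt_of_le`) can proceed by a
comparison that is monotone in `x`, by a Peierls/energy argument, or by any estimate insensitive to the
exact value `x = x_c = 1/√(2+√2)`: "diving" for a chord is the CHEAP option sub-critically and the
TYPICAL option super-critically; only critical flexibility (restriction exponent `5/8 > 0`) keeps
`q* < 1` (numerically `q* ≈ 0.9957` at aspect 2, see `Cruxes/HexTight/DrefuteOneScaleDiveNumerics.md`).
The multi-traversal stubs (`ArcShellBound`, `RootedShellBound`) by contrast fail only on the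
super-critical side. Reusable by-products: `mkArc` (a door-to-door `HexMidEdgeSAW` from a duplicate-free
lattice chain), the `3^{n-1}` coding bound `card_filter_length_eq_le` / `sum_pow_length_ge_le`, and the
disc configuration `Λd M` with its doors (a NON-VACUITY witness of `IsVirgin`/`Straddles` at every scale).
-/



noncomputable section

open scoped BigOperators
open Classical
open Literature.Probability.LatticeModels Literature.Probability.RandomPlanarGeometry
  Literature.Probability.RandomPlanarGeometry.SAW
open Summit.CriticalPhenomena.SAWScalingLimit.Theorems.HexTight.Reversal

namespace Summit.CriticalPhenomena.SAWScalingLimit.Cruxes.HexTight.Negative.Subcritical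

section

/-! ## Face bookkeeping: coordinates, the three neighbours, three lattice potentials -/

/-- every face is `U i j` or `D i j` -/
theorem face_cases (a : HexVertex) : ∃ i j : ℤ, a = U i j ∨ a = D i j :=
  ⟨a.1 0, a.1 1, face_eq a⟩

/-- face type: `0` for an up face, `1` for a down face -/
def tF (v : HexVertex) : ℤ := ((v.2 : ℕ) : ℤ)

/-- `tF` on an up face -/
@[simp] theorem tF_U (i j : ℤ) : tF (U i j) = 0 := by simp [tF, U]
/-- `tF` on a down face -/
@[simp] theorem tF_D (i j : ℤ) : tF (D i j) = 1 := by simp [tF, D]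
/-- `cA = 2 Re c` on an up face -/
@[simp] theorem cA_U (i j : ℤ) : cA (U i j) = 2 * i + j + 1 := by simp [cA, U]
/-- `cA = 2 Re c` on a down face -/
@[simp] theorem cA_D (i j : ℤ) : cA (D i j) = 2 * i + j + 2 := by simp [cA, D]; ring
/-- `cB = (6/√3) Im c` on an up face -/
@[simp] theorem cB_U (i j : ℤ) : cB (U i j) = 3 * j + 1 := by simp [cB, U]
/-- `cB = (6/√3) Im c` on a down face -/
@[simp] theorem cB_D (i j : ℤ) : cB (D i j) = 3 * j + 2 := by simp [cB, D]; ring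

/-- **the six lattice steps in the coordinates `(cA, cB)`**: from an up face `(+1,+1)`, `(-1,+1)`, `(0,-2)`; from a
down face the opposite vectors. -/
theorem adj_delta {a b : HexVertex} (hab : hexGraph.Adj a b) :
    (tF a = 0 ∧ tF b = 1 ∧ (cA b = cA a + 1 ∧ cB b = cB a + 1 ∨ cA b = cA a - 1 ∧ cB b = cB a + 1 ∨
      cA b = cA a ∧ cB b = cB a - 2)) ∨
    (tF a = 1 ∧ tF b = 0 ∧ (cA b = cA a - 1 ∧ cB b = cB a - 1 ∨ cA b = cA a + 1 ∧ cB b = cB a - 1 ∨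
      cA b = cA a ∧ cB b = cB a + 2)) := by
  obtain ⟨i, j, rfl | rfl⟩ := face_cases a
  · rcases adj_U_iff.1 hab with rfl | rfl | rfl
    · simp only [tF_U, tF_D, cA_U, cA_D, cB_U, cB_D, true_and]; omega
    · simp only [tF_U, tF_D, cA_U, cA_D, cB_U, cB_D, true_and]; omega
    · simp only [tF_U, tF_D, cA_U, cA_D, cB_U, cB_D, true_and]; omega
  · rcases adj_D_iff.1 hab with rfl | rfl | rfl
    · simp only [tF_U, tF_D, cA_U, cA_D, cB_U, cB_D, true_and]; omega
    · simp only [tF_U, tF_D, cA_U, cA_D, cB_U, cB_D, true_and]; omega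
    · simp only [tF_U, tF_D, cA_U, cA_D, cB_U, cB_D, true_and]; omega

/-- the potential `3 cA - cB` (`= 2(3i+k) + 2`) drops by at most `4` along a lattice edge -/
theorem pA_step {a b : HexVertex} (hab : hexGraph.Adj a b) :
    3 * cA a - cB a ≤ 3 * cA b - cB b + 4 := by
  have := adj_delta hab; omega

/-- `3 cA - cB` drops by at most `6` along two consecutive lattice edges (a U-turn drops `0`) -/
theorem pA_pair {a b c : HexVertex} (hab : hexGraph.Adj a b) (hbc : hexGraph.Adj b c) :
    3 * cA a - cB a ≤ 3 * cA c - cB c + 6 := by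
  have := adj_delta hab; have := adj_delta hbc; omega

/-- the potential `3 cA + cB` (`= 2(3(i+j)+2k) + 4`) drops by at most `4` along a lattice edge -/
theorem pB_step {a b : HexVertex} (hab : hexGraph.Adj a b) :
    3 * cA a + cB a ≤ 3 * cA b + cB b + 4 := by
  have := adj_delta hab; omega

/-- `3 cA + cB` drops by at most `6` along two consecutive lattice edges -/
theorem pB_pair {a b c : HexVertex} (hab : hexGraph.Adj a b) (hbc : hexGraph.Adj b c) :
    3 * cA a + cB a ≤ 3 * cA c + cB c + 6 := by
  have := adj_delta hab; have := adj_delta hbc; omega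

/-- `cA` moves by at most `1` along a lattice edge -/
theorem cA_step {a b : HexVertex} (hab : hexGraph.Adj a b) : cA a ≤ cA b + 1 ∧ cA b ≤ cA a + 1 := by
  have := adj_delta hab; omega

/-- `12 ‖c(v)‖² = 3 cA² + cB²` -/
theorem norm_sq_hexCenter (v : HexVertex) :
    ‖hexCenter v‖ ^ 2 = ((3 * cA v ^ 2 + cB v ^ 2 : ℤ) : ℝ) / 12 := by
  rw [Complex.sq_norm, Complex.normSq_apply, re_eq_cA, im_eq_cB]
  have h3 : Real.sqrt 3 * Real.sqrt 3 = 3 := Real.mul_self_sqrt (by norm_num)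
  push_cast
  nlinarith [h3]

/-! ## Chains: the potential bound and the discrete intermediate value property -/

/-- along a lattice chain with `s` steps a potential with step drop `≤ 4` and two-step drop `≤ 6` drops
by at most `3s+1` -/
theorem chain_drop_le (p : HexVertex → ℤ) (h1 : ∀ a b, hexGraph.Adj a b → p a ≤ p b + 4)
    (h2 : ∀ a b c, hexGraph.Adj a b → hexGraph.Adj b c → p a ≤ p c + 6) :
    ∀ (n : ℕ) (a : HexVertex) (l : List HexVertex), l.length ≤ n → (a :: l).IsChain hexGraph.Adj →
      p a - p ((a :: l).getLast (List.cons_ne_nil a l)) ≤ 3 * (l.length : ℤ) + 1 := by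
  intro n
  induction n with
  | zero =>
    intro a l hl _
    have : l = [] := List.eq_nil_of_length_eq_zero (Nat.le_zero.1 hl)
    subst this
    simp
  | succ n ih =>
    intro a l hl hc
    match l, hl, hc with
    | [], _, _ => simp
    | [b], _, hc =>
      have hab : hexGraph.Adj a b := (List.isChain_cons_cons.1 hc).1
      have := h1 a b hab
      simp only [List.getLast_cons_cons, List.getLast_singleton, List.length_singleton]
      push_cast
      linarith
    | b :: c :: l', hl, hc =>
      have hab : hexGraph.Adj a b := (List.isChain_cons_cons.1 hc).1
      have hc' := (List.isChain_cons_cons.1 hc).2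
      have hbc : hexGraph.Adj b c := (List.isChain_cons_cons.1 hc').1
      have hc'' := (List.isChain_cons_cons.1 hc').2
      have hlen : l'.length ≤ n := by simp at hl; omega
      have key := ih c l' hlen hc''
      have h3 := h2 a b c hab hbc
      rw [List.getLast_cons_cons, List.getLast_cons_cons]
      simp only [List.length_cons]
      push_cast
      linarith

/-- the potential bound for a nonempty chain, in terms of `head`/`getLast`/`length` -/
theorem chain_drop_le' (p : HexVertex → ℤ) (h1 : ∀ a b, hexGraph.Adj a b → p a ≤ p b + 4)
    (h2 : ∀ a b c, hexGraph.Adj a b → hexGraph.Adj b c → p a ≤ p c + 6)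
    (m : List HexVertex) (hm : m ≠ []) (hc : m.IsChain hexGraph.Adj) :
    p (m.head hm) - p (m.getLast hm) + 2 ≤ 3 * (m.length : ℤ) := by
  obtain ⟨a, l, rfl⟩ := List.exists_cons_of_ne_nil hm
  have := chain_drop_le p h1 h2 l.length a l le_rfl hc
  simp only [List.head_cons, List.length_cons]
  push_cast
  linarith

/-- discrete intermediate value property of `cA = 2 Re c(·)` (it moves by `≤ 1` per step) -/
theorem exists_cA_eq_zero : ∀ (l : List HexVertex) (a : HexVertex), (a :: l).IsChain hexGraph.Adj →
    0 ≤ cA a → cA ((a :: l).getLast (List.cons_ne_nil a l)) ≤ 0 → ∃ P ∈ a :: l, cA P = 0 := by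
  intro l
  induction l with
  | nil =>
    intro a _ h0 h1
    exact ⟨a, by simp, le_antisymm (by simpa using h1) h0⟩
  | cons b l ih =>
    intro a hc h0 h1
    by_cases ha : cA a = 0
    · exact ⟨a, by simp, ha⟩
    · have hab : hexGraph.Adj a b := (List.isChain_cons_cons.1 hc).1
      have hb : 0 ≤ cA b := by have := (cA_step hab).1; omega
      rw [List.getLast_cons_cons] at h1
      obtain ⟨P, hP, hP0⟩ := ih b (List.isChain_cons_cons.1 hc).2 hb h1
      exact ⟨P, List.mem_cons_of_mem a hP, hP0⟩

/-! ## The length bound for non-diving chains between the antipodal doors -/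

/-- **Non-diving chains are long.** A lattice chain from `U(M,0)` to `U(-M-1,0)` whose cells `P` on the
imaginary axis (`cA P = 0`) satisfy `cB(P)² ≥ 3M² + 3M + 2` (i.e. `‖c(P)‖ > N_M/2`) has `≥ 5M+3` cells:
it passes such a `P` (`exists_cA_eq_zero`); towards `P` the potential `3cA ∓ cB` falls by `6M+2+|cB P|`,
after `P` the potential `3cA ± cB` falls by as much, each at rate `≤ 3` per cell (`chain_drop_le'`), and
`2|cB P| ≥ 3M+2`. -/
theorem length_ge_of_far (M : ℕ) (m : List HexVertex) (hm : m ≠ []) (hc : m.IsChain hexGraph.Adj)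
    (hhead : m.head hm = U M 0) (hlast : m.getLast hm = U (-(M : ℤ) - 1) 0)
    (hfar : ∀ P ∈ m, cA P = 0 → 3 * (M : ℤ) ^ 2 + 3 * M + 2 ≤ cB P ^ 2) :
    5 * M + 3 ≤ m.length := by
  obtain ⟨a, l, rfl⟩ := List.exists_cons_of_ne_nil hm
  simp only [List.head_cons] at hhead
  subst hhead
  -- a pivot on the imaginary axis
  obtain ⟨P, hPm, hP0⟩ := exists_cA_eq_zero l (U M 0) hc (by rw [cA_U]; omega)
    (by rw [hlast, cA_U]; omega)
  have hPB := hfar P hPm hP0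
  obtain ⟨s, t, hst⟩ := List.append_of_mem hPm
  -- the two sub-chains
  have hc1 : (s ++ [P]).IsChain hexGraph.Adj := by
    have : (U (M : ℤ) 0 :: l) = (s ++ [P]) ++ t := by rw [hst]; simp
    rw [this] at hc
    exact hc.left_of_append
  have hc2 : (P :: t).IsChain hexGraph.Adj := by
    rw [hst] at hc
    exact hc.right_of_append
  have hne1 : s ++ [P] ≠ [] := by simp
  have hhead1 : (s ++ [P]).head hne1 = U M 0 := by
    have h' : (U (M : ℤ) 0 :: l).head (List.cons_ne_nil _ _) = U M 0 := rfl
    rw [← h']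
    simp only [hst]
    cases s <;> rfl
  have hlast1 : (s ++ [P]).getLast hne1 = P := by simp
  have hlast2 : (P :: t).getLast (List.cons_ne_nil _ _) = U (-(M : ℤ) - 1) 0 := by
    rw [← hlast]
    simp only [hst]
    rw [List.getLast_append_of_ne_nil _ (List.cons_ne_nil _ _)]
  have hlen : (U (M : ℤ) 0 :: l).length = s.length + 1 + t.length := by
    rw [hst]; simp; omega
  rw [hlen]
  have hb0 : cB P ≠ 0 := by
    intro h; rw [h] at hPB; nlinarith
  rcases lt_or_gt_of_ne hb0 with hneg | hpos
  · -- the chain passes BELOW the centre: `3cA + cB` first, then `3cA - cB`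
    have h1 := chain_drop_le' (fun v => 3 * cA v + cB v) (fun _ _ => pB_step) (fun _ _ _ => pB_pair)
      (s ++ [P]) hne1 hc1
    have h2 := chain_drop_le' (fun v => 3 * cA v - cB v) (fun _ _ => pA_step) (fun _ _ _ => pA_pair)
      (P :: t) (List.cons_ne_nil _ _) hc2
    rw [hhead1, hlast1] at h1
    rw [List.head_cons, hlast2] at h2
    simp only [cA_U, cB_U, hP0, List.length_append, List.length_cons, List.length_nil] at h1 h2
    push_cast at h1 h2
    have hb : 3 * (M : ℤ) + 2 ≤ -2 * cB P := by nlinarith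
    omega
  · -- the chain passes ABOVE: `3cA - cB` first, then `3cA + cB`
    have h1 := chain_drop_le' (fun v => 3 * cA v - cB v) (fun _ _ => pA_step) (fun _ _ _ => pA_pair)
      (s ++ [P]) hne1 hc1
    have h2 := chain_drop_le' (fun v => 3 * cA v + cB v) (fun _ _ => pB_step) (fun _ _ _ => pB_pair)
      (P :: t) (List.cons_ne_nil _ _) hc2
    rw [hhead1, hlast1] at h1
    rw [List.head_cons, hlast2] at h2
    simp only [cA_U, cB_U, hP0, List.length_append, List.length_cons, List.length_nil] at h1 h2
    push_cast at h1 h2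
    have hb : 3 * (M : ℤ) + 2 ≤ 2 * cB P := by nlinarith
    omega

/-! ## Counting arcs from a door: at most `3^{n-1}` with `n` cells -/

/-- the three lattice neighbours of a face, listed -/
def nb (v : HexVertex) (t : Fin 3) : HexVertex :=
  if v.2 = 0 then ![D (v.1 0) (v.1 1), D (v.1 0 - 1) (v.1 1), D (v.1 0) (v.1 1 - 1)] t
  else ![U (v.1 0) (v.1 1), U (v.1 0 + 1) (v.1 1), U (v.1 0) (v.1 1 + 1)] t

/-- a lattice neighbour is one of the three listed ones -/
theorem exists_nb_eq {a b : HexVertex} (hab : hexGraph.Adj a b) : ∃ t : Fin 3, nb a t = b := by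
  obtain ⟨i, j, rfl | rfl⟩ := face_cases a
  · rcases adj_U_iff.1 hab with rfl | rfl | rfl
    · exact ⟨0, by simp [nb, U]⟩
    · exact ⟨1, by simp [nb, U]⟩
    · exact ⟨2, by simp [nb, U]⟩
  · rcases adj_D_iff.1 hab with rfl | rfl | rfl
    · exact ⟨0, by simp [nb, D]⟩
    · exact ⟨1, by simp [nb, D]⟩
    · exact ⟨2, by simp [nb, D]⟩

/-- index of a neighbour -/
def idx (a b : HexVertex) : Fin 3 :=
  if h : ∃ t : Fin 3, nb a t = b then Classical.choose h else 0

/-- the index recovers the neighbour -/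
theorem nb_idx {a b : HexVertex} (hab : hexGraph.Adj a b) : nb a (idx a b) = b := by
  have h := exists_nb_eq hab
  rw [idx, dif_pos h]
  exact Classical.choose_spec h

/-- the code of a chain: the list of neighbour indices of its steps -/
def code : List HexVertex → List (Fin 3)
  | a :: b :: l => idx a b :: code (b :: l)
  | _ => []

/-- rebuilding a chain from its first cell and its code -/
def decode : HexVertex → List (Fin 3) → List HexVertex
  | a, [] => [a]
  | a, t :: ts => a :: decode (nb a t) ts

/-- the code of a chain with `n+1` cells has length `n` -/
theorem length_code : ∀ (l : List HexVertex) (a : HexVertex), (code (a :: l)).length = l.length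
  | [], _ => rfl
  | b :: l, a => by simp [code, length_code l b]

/-- a lattice chain is determined by its first cell and its code -/
theorem decode_code : ∀ (l : List HexVertex) (a : HexVertex), (a :: l).IsChain hexGraph.Adj →
    decode a (code (a :: l)) = a :: l
  | [], a, _ => rfl
  | b :: l, a, hc => by
    have hab : hexGraph.Adj a b := (List.isChain_cons_cons.1 hc).1
    simp only [code, decode, nb_idx hab, decode_code l b (List.isChain_cons_cons.1 hc).2]


end

section

/-! ## The one-scale dive statement at a general fugacity -/

/-- `Z^H_Λ(w → w')` at fugacity `x`: `Σ_{H-arcs} x^{ℓ(γ)}` (at `x = x_c` this is `Reversal.arcMass`). -/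
def arcMassAt (x : ℝ) (H : SimpleGraph HexVertex) (Λ : Finset HexVertex) (w w' : Sym2 HexVertex) : ℝ :=
  ∑ γ : HexMidEdgeSAW Λ w w', if IsHArc H γ then x ^ γ.length else 0

/-- the `x`-mass of the `H`-arcs `w → w'` of `Λ` visiting the closed disc `B̄(z₀, r)`
(at `x = x_c` this is `Reversal.diveMass`). -/
def diveMassAt (x : ℝ) (H : SimpleGraph HexVertex) (Λ : Finset HexVertex) (w w' : Sym2 HexVertex)
    (z₀ : ℂ) (r : ℝ) : ℝ :=
  ∑ γ : HexMidEdgeSAW Λ w w',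
    if IsHArc H γ ∧ ∃ v ∈ γ.verts, dist (hexCenter v) z₀ ≤ r then x ^ γ.length else 0

/-- the mass of the NON-diving `H`-arcs at fugacity `x`. -/
def stayMassAt (x : ℝ) (H : SimpleGraph HexVertex) (Λ : Finset HexVertex) (w w' : Sym2 HexVertex)
    (z₀ : ℂ) (r : ℝ) : ℝ :=
  ∑ γ : HexMidEdgeSAW Λ w w',
    if IsHArc H γ ∧ ¬ ∃ v ∈ γ.verts, dist (hexCenter v) z₀ ≤ r then x ^ γ.length else 0

/-- **`OneScaleDive` at fugacity `x`**: the statement of `stub_oneScaleDive` with `x_c` replaced by `x`. -/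
def OneScaleDiveAt (x : ℝ) : Prop :=
  ∃ q : ℝ, 0 ≤ q ∧ q < 1 ∧ ∃ N₀ : ℝ, ∀ (H : SimpleGraph HexVertex) (Λ : Finset HexVertex)
    (z₀ : ℂ) (N : ℝ) (w w' : Sym2 HexVertex), N₀ ≤ N →
    IsVirgin H Λ z₀ N → Straddles Λ z₀ N w → Straddles Λ z₀ N w' →
    diveMassAt x H Λ w w' z₀ (N / 2) ≤ q * arcMassAt x H Λ w w'

/-- At `x = x_c`, `OneScaleDiveAt` is VERBATIM the registered stub `stub_oneScaleDive` of the line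
(stated over the landed objects `Reversal.diveMass` / `Reversal.arcMass`; inside this namespace the bare
name `arcMass` would resolve to the pinned copy of `Negative/LatticeG2Defs.lean`, hence the full names). -/
theorem oneScaleDiveAt_critical_iff :
    OneScaleDiveAt hexCriticalFugacity ↔
      ∃ q : ℝ, 0 ≤ q ∧ q < 1 ∧ ∃ N₀ : ℝ, ∀ (H : SimpleGraph HexVertex) (Λ : Finset HexVertex)
        (z₀ : ℂ) (N : ℝ) (w w' : Sym2 HexVertex), N₀ ≤ N →
        IsVirgin H Λ z₀ N → Straddles Λ z₀ N w → Straddles Λ z₀ N w' →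
        Summit.CriticalPhenomena.SAWScalingLimit.Theorems.HexTight.Reversal.diveMass H Λ w w' z₀ (N / 2) ≤
          q * Summit.CriticalPhenomena.SAWScalingLimit.Theorems.HexTight.Reversal.arcMass H Λ w w' :=
  Iff.rfl

/-- **`BulkOneArmDecay` at fugacity `x`**: the line's milestone M1 (`bulkOneArmDecay_of`, proved there from
`DiveRecursion` + `OneScaleDive`) with `x_c` replaced by `x`. -/
def BulkOneArmDecayAt (x : ℝ) : Prop :=
  ∃ q : ℝ, 0 ≤ q ∧ q < 1 ∧ ∃ N₀ : ℝ, ∀ (m : ℕ) (H : SimpleGraph HexVertex)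
    (Λ : Finset HexVertex) (z₀ : ℂ) (N : ℝ) (w w' : Sym2 HexVertex), N₀ ≤ N →
    IsVirgin H Λ z₀ (2 ^ m * N) → Straddles Λ z₀ (2 ^ m * N) w →
    Straddles Λ z₀ (2 ^ m * N) w' →
    diveMassAt x H Λ w w' z₀ N ≤ q ^ m * arcMassAt x H Λ w w'

/-- At `x = x_c`, `BulkOneArmDecayAt` is VERBATIM the line's `BulkOneArmDecay`. -/
theorem bulkOneArmDecayAt_critical_iff :
    BulkOneArmDecayAt hexCriticalFugacity ↔
      ∃ q : ℝ, 0 ≤ q ∧ q < 1 ∧ ∃ N₀ : ℝ, ∀ (m : ℕ) (H : SimpleGraph HexVertex)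
        (Λ : Finset HexVertex) (z₀ : ℂ) (N : ℝ) (w w' : Sym2 HexVertex), N₀ ≤ N →
        IsVirgin H Λ z₀ (2 ^ m * N) → Straddles Λ z₀ (2 ^ m * N) w →
        Straddles Λ z₀ (2 ^ m * N) w' →
        Summit.CriticalPhenomena.SAWScalingLimit.Theorems.HexTight.Reversal.diveMass H Λ w w' z₀ N ≤
          q ^ m * Summit.CriticalPhenomena.SAWScalingLimit.Theorems.HexTight.Reversal.arcMass H Λ w w' :=
  Iff.rfl

/-- the one-arm decay at level `m = 1` is the one-scale dive bound (at every fugacity) -/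
theorem oneScaleDiveAt_of_bulk {x : ℝ} (h : BulkOneArmDecayAt x) : OneScaleDiveAt x := by
  obtain ⟨q, hq0, hq1, N₀, h⟩ := h
  refine ⟨q, hq0, hq1, 2 * N₀, fun H Λ z₀ N w w' hN hV hw hw' => ?_⟩
  have e : (2 : ℝ) ^ 1 * (N / 2) = N := by ring
  have key := h 1 H Λ z₀ (N / 2) w w' (by linarith) (by rw [e]; exact hV) (by rw [e]; exact hw)
    (by rw [e]; exact hw')
  simpa only [pow_one] using key

variable {x : ℝ} {H : SimpleGraph HexVertex} {Λ : Finset HexVertex} {w w' : Sym2 HexVertex}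
  {z₀ : ℂ} {r : ℝ}

/-- arc mass = dive mass + stay mass (termwise). -/
theorem arcMassAt_eq_add (x : ℝ) (H : SimpleGraph HexVertex) (Λ : Finset HexVertex)
    (w w' : Sym2 HexVertex) (z₀ : ℂ) (r : ℝ) :
    arcMassAt x H Λ w w' = diveMassAt x H Λ w w' z₀ r + stayMassAt x H Λ w w' z₀ r := by
  unfold arcMassAt diveMassAt stayMassAt
  rw [← Finset.sum_add_distrib]
  refine Finset.sum_congr rfl fun γ _ => ?_
  by_cases hA : IsHArc H γ
  · by_cases hB : ∃ v ∈ γ.verts, dist (hexCenter v) z₀ ≤ r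
    · rw [if_pos hA, if_pos ⟨hA, hB⟩, if_neg (fun h => h.2 hB), add_zero]
    · rw [if_pos hA, if_neg (fun h => hB h.2), if_pos ⟨hA, hB⟩, zero_add]
  · rw [if_neg hA, if_neg (fun h => hA h.1), if_neg (fun h => hA h.1), add_zero]

/-- In a domain `Λ`, from a door `w = {u, c}` with `u ∉ Λ`: every nonempty arc starts at `c`. -/
theorem head_eq_of_door {u c : HexVertex} (hu : u ∉ Λ) (γ : HexMidEdgeSAW Λ s(u, c) w')
    (hne : γ.verts ≠ []) : γ.verts.head hne = c := by
  have hmem := γ.head_mem (γ.verts.head hne) (List.head?_eq_some_head hne)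
  rcases Sym2.mem_iff.1 hmem with h | h
  · exact absurd (h ▸ γ.subset _ (List.head_mem hne)) hu
  · exact h

/-- **at most `3^{n-1}` arcs with `n` cells from a door** -/
theorem card_filter_length_eq_le {u c : HexVertex} (hu : u ∉ Λ) (n : ℕ) :
    (Finset.univ.filter fun γ : HexMidEdgeSAW Λ s(u, c) w' => γ.length = n).card ≤ 3 ^ (n - 1) := by
  classical
  rw [← Fintype.card_subtype]
  have hlen : ∀ γ : {γ : HexMidEdgeSAW Λ s(u, c) w' // γ.length = n},
      (code γ.1.verts).length = n - 1 := by
    rintro ⟨γ, hγ⟩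
    rcases h : γ.verts with _ | ⟨a, l⟩
    · have : γ.length = 0 := by simp [HexMidEdgeSAW.length, h]
      simp only [code, List.length_nil]
      omega
    · rw [length_code]
      have : γ.length = l.length + 1 := by simp [HexMidEdgeSAW.length, h]
      omega
  let f : {γ : HexMidEdgeSAW Λ s(u, c) w' // γ.length = n} → List.Vector (Fin 3) (n - 1) :=
    fun γ => ⟨code γ.1.verts, hlen γ⟩
  have hf : Function.Injective f := by
    rintro ⟨γ₁, hγ₁⟩ ⟨γ₂, hγ₂⟩ heq
    have heq' : code γ₁.verts = code γ₂.verts := congrArg Subtype.val heq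
    rw [Subtype.mk.injEq]
    apply HexMidEdgeSAW.ext
    rcases h₁ : γ₁.verts with _ | ⟨a₁, l₁⟩ <;> rcases h₂ : γ₂.verts with _ | ⟨a₂, l₂⟩
    · rfl
    · exfalso
      have e1 : γ₁.length = 0 := by simp [HexMidEdgeSAW.length, h₁]
      have e2 : γ₂.length = l₂.length + 1 := by simp [HexMidEdgeSAW.length, h₂]
      omega
    · exfalso
      have e1 : γ₁.length = l₁.length + 1 := by simp [HexMidEdgeSAW.length, h₁]
      have e2 : γ₂.length = 0 := by simp [HexMidEdgeSAW.length, h₂]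
      omega
    · have ha₁ : a₁ = c := by
        have := head_eq_of_door (w' := w') hu γ₁ (by rw [h₁]; simp)
        simpa [h₁] using this
      have ha₂ : a₂ = c := by
        have := head_eq_of_door (w' := w') hu γ₂ (by rw [h₂]; simp)
        simpa [h₂] using this
      rw [ha₁] at h₁ ⊢
      rw [ha₂] at h₂ ⊢
      have hc₁ : (c :: l₁).IsChain hexGraph.Adj := h₁ ▸ γ₁.isChain
      have hc₂ : (c :: l₂).IsChain hexGraph.Adj := h₂ ▸ γ₂.isChain
      rw [h₁, h₂] at heq'
      rw [← decode_code l₁ c hc₁, ← decode_code l₂ c hc₂, heq']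
  calc Fintype.card {γ : HexMidEdgeSAW Λ s(u, c) w' // γ.length = n}
      ≤ Fintype.card (List.Vector (Fin 3) (n - 1)) := Fintype.card_le_of_injective f hf
    _ = 3 ^ (n - 1) := by rw [card_vector, Fintype.card_fin]

/-- an arc has at most `|Λ|` cells -/
theorem length_le_card (γ : HexMidEdgeSAW Λ w w') : γ.length ≤ Λ.card := by
  rw [HexMidEdgeSAW.length, ← List.toFinset_card_of_nodup γ.nodup]
  exact Finset.card_le_card fun v hv => γ.subset v (List.mem_toFinset.1 hv)

/-- **the mass of the long arcs from a door**: `Σ_{ℓ(γ) ≥ n₁} x^{ℓ(γ)} ≤ (3x)^{n₁} / (1 - 3x)`. -/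
theorem sum_pow_length_ge_le {u c : HexVertex} (hu : u ∉ Λ) {x : ℝ} (hx : 0 ≤ x) (h3x : 3 * x < 1)
    (n₁ : ℕ) :
    (∑ γ : HexMidEdgeSAW Λ s(u, c) w', if n₁ ≤ γ.length then x ^ γ.length else 0) ≤
      (3 * x) ^ n₁ / (1 - 3 * x) := by
  classical
  set B := Λ.card + 1 with hB
  have hfib : ∀ γ : HexMidEdgeSAW Λ s(u, c) w', (if n₁ ≤ γ.length then x ^ γ.length else 0) =
      ∑ n ∈ Finset.Ico n₁ B, if γ.length = n then x ^ n else 0 := by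
    intro γ
    rw [Finset.sum_ite_eq]
    have hlt : γ.length < B := Nat.lt_succ_of_le (length_le_card γ)
    by_cases hn : n₁ ≤ γ.length
    · rw [if_pos hn, if_pos (Finset.mem_Ico.2 ⟨hn, hlt⟩)]
    · rw [if_neg hn, if_neg (fun h => hn (Finset.mem_Ico.1 h).1)]
  rw [Finset.sum_congr rfl (fun γ _ => hfib γ), Finset.sum_comm]
  have h3x0 : 0 ≤ 3 * x := by positivity
  refine le_trans (Finset.sum_le_sum fun n hn => ?_) (geom_sum_Ico_le_of_lt_one h3x0 h3x)
  have hcount : (∑ γ : HexMidEdgeSAW Λ s(u, c) w', if γ.length = n then x ^ n else (0 : ℝ)) =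
      ((Finset.univ.filter fun γ : HexMidEdgeSAW Λ s(u, c) w' => γ.length = n).card : ℝ) * x ^ n := by
    rw [Finset.sum_ite, Finset.sum_const_zero, add_zero, Finset.sum_const, nsmul_eq_mul]
  rw [hcount]
  have hcard := card_filter_length_eq_le (w' := w') (Λ := Λ) (c := c) hu n
  calc ((Finset.univ.filter fun γ : HexMidEdgeSAW Λ s(u, c) w' => γ.length = n).card : ℝ) * x ^ n
      ≤ (3 : ℝ) ^ (n - 1) * x ^ n :=
        mul_le_mul_of_nonneg_right (by exact_mod_cast hcard) (pow_nonneg hx n)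
    _ ≤ 3 ^ n * x ^ n :=
        mul_le_mul_of_nonneg_right (pow_le_pow_right₀ (by norm_num) (Nat.sub_le n 1)) (pow_nonneg hx n)
    _ = (3 * x) ^ n := by rw [mul_pow]

/-! ## Building a door-to-door arc from a duplicate-free lattice chain -/

/-- the consecutive-pair edges of a list have their endpoints in the list -/
theorem mem_of_mem_zipWith_mk : ∀ (l : List HexVertex) (e : Sym2 HexVertex),
    e ∈ List.zipWith (fun a b => s(a, b)) l l.tail → ∀ z ∈ e, z ∈ l
  | [], e, he => by simp at he
  | [a], e, he => by simp at he
  | a :: b :: l, e, he => by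
    simp only [List.tail_cons, List.zipWith_cons_cons, List.mem_cons] at he
    intro z hz
    rcases he with rfl | he
    · rcases Sym2.mem_iff.1 hz with rfl | rfl <;> simp
    · exact List.mem_cons_of_mem a (mem_of_mem_zipWith_mk (b :: l) e he z hz)

/-- a duplicate-free list has duplicate-free consecutive-pair edges -/
theorem nodup_zipWith_mk : ∀ (l : List HexVertex), l.Nodup →
    (List.zipWith (fun a b => s(a, b)) l l.tail).Nodup
  | [], _ => by simp
  | [a], _ => by simp
  | a :: b :: l, h => by
    have hn : (b :: l).Nodup := h.of_cons
    have ha : a ∉ b :: l := (List.nodup_cons.1 h).1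
    simp only [List.tail_cons, List.zipWith_cons_cons, List.nodup_cons]
    refine ⟨fun hmem => ha ?_, nodup_zipWith_mk (b :: l) hn⟩
    exact mem_of_mem_zipWith_mk (b :: l) _ hmem a (Sym2.mem_mk_left a b)

/-- **a door-to-door arc from a duplicate-free lattice chain** whose end cells are `c`, `c'`, with
outside cells `u, u' ∉ Λ` (`u ∼ c`) and distinct doors. -/
def mkArc (l : List HexVertex) (hl : l ≠ []) (hnd : l.Nodup) (hc : l.IsChain hexGraph.Adj)
    (hΛ : ∀ v ∈ l, v ∈ Λ) {u u' c c' : HexVertex} (hu : u ∉ Λ) (hu' : u' ∉ Λ)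
    (hhead : l.head hl = c) (hlast : l.getLast hl = c')
    (hadj : hexGraph.Adj u c) (hne : s(u, c) ≠ s(u', c')) :
    HexMidEdgeSAW Λ s(u, c) s(u', c') where
  verts := l
  subset := hΛ
  nodup := hnd
  isChain := hc
  head_mem v hv := by
    rw [List.head?_eq_some_head hl, Option.some.injEq] at hv
    rw [← hv, hhead]
    exact Sym2.mem_mk_right u c
  getLast_mem v hv := by
    rw [List.getLast?_eq_some_getLast hl, Option.some.injEq] at hv
    rw [← hv, hlast]
    exact Sym2.mem_mk_right u' c'
  eq_of_nil h := absurd h hl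
  edges_nodup _ := by
    have hw' : s(u', c') ∉ List.zipWith (fun a b => s(a, b)) l l.tail := fun h =>
      hu' (hΛ u' (mem_of_mem_zipWith_mk l _ h u' (Sym2.mem_mk_left u' c')))
    have hw : s(u, c) ∉ List.zipWith (fun a b => s(a, b)) l l.tail := fun h =>
      hu (hΛ u (mem_of_mem_zipWith_mk l _ h u (Sym2.mem_mk_left u c)))
    rw [List.nodup_append_comm, List.singleton_append, List.nodup_cons, List.nodup_cons, List.mem_cons,
      not_or]
    exact ⟨⟨hne.symm, hw'⟩, hw, nodup_zipWith_mk l hnd⟩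
  fst_mem := ⟨(SimpleGraph.mem_edgeSet hexGraph).2 hadj, c, Sym2.mem_mk_right u c,
    hΛ c (hhead ▸ List.head_mem hl)⟩

/-- the cells of `mkArc` -/
@[simp] theorem mkArc_verts (l : List HexVertex) (hl : l ≠ []) (hnd : l.Nodup)
    (hc : l.IsChain hexGraph.Adj) (hΛ : ∀ v ∈ l, v ∈ Λ) {u u' c c' : HexVertex} (hu : u ∉ Λ)
    (hu' : u' ∉ Λ) (hhead : l.head hl = c) (hlast : l.getLast hl = c') (hadj : hexGraph.Adj u c)
    (hne : s(u, c) ≠ s(u', c')) :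
    (mkArc l hl hnd hc hΛ hu hu' hhead hlast hadj hne).verts = l := rfl

/-- from a door `{u', c'}` at the end (`u' ∉ Λ`): every nonempty arc ends at `c'` -/
theorem getLast_eq_of_door {u' c' : HexVertex} (hu' : u' ∉ Λ) (γ : HexMidEdgeSAW Λ w s(u', c'))
    (hne : γ.verts ≠ []) : γ.verts.getLast hne = c' := by
  have hmem := γ.getLast_mem (γ.verts.getLast hne) (List.getLast?_eq_some_getLast hne)
  rcases Sym2.mem_iff.1 hmem with h | h
  · exact absurd (h ▸ γ.subset _ (List.getLast_mem hne)) hu'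
  · exact h


end

section

variable {x : ℝ} {Λ : Finset HexVertex} {w w' : Sym2 HexVertex}

/-! ## The blocked disc `Λ_M`, its two antipodal doors, the zigzag diver -/

/-- the radius `N_M = ‖c(U(M,0))‖ = √((M + ½)² + 1/12)` -/
def NM (M : ℕ) : ℝ := ‖hexCenter (U M 0)‖

/-- `N_M ≥ 0` -/
theorem NM_nonneg (M : ℕ) : 0 ≤ NM M := norm_nonneg _

/-- `12 ‖c(v)‖² = 3 cA² + cB²`, cast form -/
theorem twelve_norm_sq (v : HexVertex) :
    12 * ‖hexCenter v‖ ^ 2 = ((3 * cA v ^ 2 + cB v ^ 2 : ℤ) : ℝ) := by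
  rw [norm_sq_hexCenter]; ring

/-- `12 N_M² = 3 (2M+1)² + 1` -/
theorem twelve_NM_sq (M : ℕ) : 12 * NM M ^ 2 = ((3 * (2 * (M : ℤ) + 1) ^ 2 + 1 : ℤ) : ℝ) := by
  rw [NM, twelve_norm_sq, cA_U, cB_U]; push_cast; ring

/-- `‖c(v)‖ ≤ N_M` in integer coordinates -/
theorem norm_le_NM_iff {M : ℕ} {v : HexVertex} :
    ‖hexCenter v‖ ≤ NM M ↔ 3 * cA v ^ 2 + cB v ^ 2 ≤ 3 * (2 * (M : ℤ) + 1) ^ 2 + 1 := by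
  have h1 := twelve_norm_sq v
  have h2 := twelve_NM_sq M
  constructor
  · intro h
    have hsq : ‖hexCenter v‖ ^ 2 ≤ NM M ^ 2 := pow_le_pow_left₀ (norm_nonneg _) h 2
    exact_mod_cast (show ((3 * cA v ^ 2 + cB v ^ 2 : ℤ) : ℝ) ≤ ((3 * (2 * (M : ℤ) + 1) ^ 2 + 1 : ℤ) : ℝ)
      by linarith)
  · intro h
    have h' : ((3 * cA v ^ 2 + cB v ^ 2 : ℤ) : ℝ) ≤ ((3 * (2 * (M : ℤ) + 1) ^ 2 + 1 : ℤ) : ℝ) := by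
      exact_mod_cast h
    exact le_of_pow_le_pow_left₀ two_ne_zero (NM_nonneg M) (by linarith)

/-- `N_M < ‖c(v)‖` in integer coordinates -/
theorem NM_lt_norm_iff {M : ℕ} {v : HexVertex} :
    NM M < ‖hexCenter v‖ ↔ 3 * (2 * (M : ℤ) + 1) ^ 2 + 1 < 3 * cA v ^ 2 + cB v ^ 2 := by
  rw [← not_le, norm_le_NM_iff, not_le]

/-- the dive condition `‖c(v)‖ ≤ N_M / 2` in integer coordinates -/
theorem dist_le_half_iff {M : ℕ} {v : HexVertex} :
    dist (hexCenter v) 0 ≤ NM M / 2 ↔ 4 * (3 * cA v ^ 2 + cB v ^ 2) ≤ 3 * (2 * (M : ℤ) + 1) ^ 2 + 1 := by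
  have h1 := twelve_norm_sq v
  have h2 := twelve_NM_sq M
  rw [dist_zero_right]
  constructor
  · intro h
    have hsq : ‖hexCenter v‖ ^ 2 ≤ (NM M / 2) ^ 2 := pow_le_pow_left₀ (norm_nonneg _) h 2
    exact_mod_cast (show ((4 * (3 * cA v ^ 2 + cB v ^ 2) : ℤ) : ℝ) ≤
      ((3 * (2 * (M : ℤ) + 1) ^ 2 + 1 : ℤ) : ℝ) by push_cast at h1 h2 ⊢; nlinarith)
  · intro h
    have h' : ((4 * (3 * cA v ^ 2 + cB v ^ 2) : ℤ) : ℝ) ≤ ((3 * (2 * (M : ℤ) + 1) ^ 2 + 1 : ℤ) : ℝ) := by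
      exact_mod_cast h
    refine le_of_pow_le_pow_left₀ two_ne_zero (div_nonneg (NM_nonneg M) (by norm_num)) ?_
    push_cast at h1 h2 h' ⊢
    nlinarith

/-- `N_M ≥ M + 1/2` -/
theorem half_le_NM (M : ℕ) : (M : ℝ) + 1 / 2 ≤ NM M := by
  have h2 := twelve_NM_sq M
  refine le_of_pow_le_pow_left₀ two_ne_zero (NM_nonneg M) ?_
  push_cast at h2
  nlinarith

/-- the faces with both indices in `[-B, B]` -/
def faces (B : ℤ) : Finset HexVertex :=
  ((Finset.Icc (-B) B ×ˢ Finset.Icc (-B) B).image fun p : ℤ × ℤ => U p.1 p.2) ∪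
    ((Finset.Icc (-B) B ×ˢ Finset.Icc (-B) B).image fun p : ℤ × ℤ => D p.1 p.2)

/-- up faces of the box -/
theorem U_mem_faces {B i j : ℤ} (hi : -B ≤ i ∧ i ≤ B) (hj : -B ≤ j ∧ j ≤ B) : U i j ∈ faces B :=
  Finset.mem_union_left _ (Finset.mem_image.2
    ⟨(i, j), Finset.mem_product.2 ⟨Finset.mem_Icc.2 hi, Finset.mem_Icc.2 hj⟩, rfl⟩)

/-- down faces of the box -/
theorem D_mem_faces {B i j : ℤ} (hi : -B ≤ i ∧ i ≤ B) (hj : -B ≤ j ∧ j ≤ B) : D i j ∈ faces B :=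
  Finset.mem_union_right _ (Finset.mem_image.2
    ⟨(i, j), Finset.mem_product.2 ⟨Finset.mem_Icc.2 hi, Finset.mem_Icc.2 hj⟩, rfl⟩)

/-- **the blocked disc** `Λ_M = {v : ‖c(v)‖ ≤ N_M}` -/
def Λd (M : ℕ) : Finset HexVertex :=
  (faces (2 * M + 4)).filter fun v => ‖hexCenter v‖ ≤ NM M

/-- **membership in the blocked disc is the norm condition** (the box is large enough) -/
theorem mem_Λd {M : ℕ} {v : HexVertex} : v ∈ Λd M ↔ ‖hexCenter v‖ ≤ NM M := by
  rw [Λd, Finset.mem_filter, and_iff_right_iff_imp]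
  intro hv
  have h := norm_le_NM_iff.1 hv
  have hA : cA v ^ 2 ≤ (2 * (M : ℤ) + 1) ^ 2 := by
    have h0 : 0 ≤ cB v ^ 2 := sq_nonneg _
    generalize cA v ^ 2 = X at h ⊢
    generalize cB v ^ 2 = Y at h h0
    generalize (2 * (M : ℤ) + 1) ^ 2 = K at h ⊢
    omega
  have hM0 : (0 : ℤ) ≤ M := Int.natCast_nonneg M
  have hB : cB v ^ 2 ≤ (2 * (2 * (M : ℤ) + 1)) ^ 2 := by
    nlinarith [sq_nonneg (cA v), mul_nonneg hM0 hM0]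
  have hA' : |cA v| ≤ 2 * (M : ℤ) + 1 := by
    have := sq_le_sq.1 hA; rwa [abs_of_nonneg (by positivity : (0 : ℤ) ≤ 2 * M + 1)] at this
  have hB' : |cB v| ≤ 2 * (2 * (M : ℤ) + 1) := by
    have := sq_le_sq.1 hB; rwa [abs_of_nonneg (by positivity : (0 : ℤ) ≤ 2 * (2 * M + 1))] at this
  rw [abs_le] at hA' hB'
  obtain ⟨i, j, rfl | rfl⟩ := face_cases v
  · simp only [cA_U, cB_U] at hA' hB'
    exact U_mem_faces (by omega) (by omega)
  · simp only [cA_D, cB_D] at hA' hB'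
    exact D_mem_faces (by omega) (by omega)

/-- the blocked disc is a virgin configuration of radius `N_M` about `0` for `H = ℍ` -/
theorem isVirgin_Λd (M : ℕ) : IsVirgin hexGraph (Λd M) 0 (NM M) :=
  ⟨fun v hv => mem_Λd.2 (by rw [dist_zero_right] at hv; exact hv.le), fun _ _ _ _ h => h⟩

/-- the east door cell lies in the disc -/
theorem U_mem_Λd (M : ℕ) : U M 0 ∈ Λd M := mem_Λd.2 le_rfl

/-- the west door cell lies in the disc -/
theorem U'_mem_Λd (M : ℕ) : U (-(M : ℤ) - 1) 0 ∈ Λd M := by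
  rw [mem_Λd, norm_le_NM_iff, cA_U, cB_U]; nlinarith [Int.natCast_nonneg M]

/-- the cell outside the east door is not in the disc -/
theorem D_not_mem_Λd (M : ℕ) : D M 0 ∉ Λd M := by
  rw [mem_Λd, norm_le_NM_iff, cA_D, cB_D]
  have := Int.natCast_nonneg M
  intro h; nlinarith

/-- the cell outside the west door is not in the disc -/
theorem D'_not_mem_Λd (M : ℕ) : D (-(M : ℤ) - 2) 0 ∉ Λd M := by
  rw [mem_Λd, norm_le_NM_iff, cA_D, cB_D]
  have := Int.natCast_nonneg M
  intro h; nlinarith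

/-- the west door is a lattice edge -/
theorem adj_D'_U' (M : ℕ) : hexGraph.Adj (D (-(M : ℤ) - 2) 0) (U (-(M : ℤ) - 1) 0) := by
  rw [show (-(M : ℤ) - 2) = -(M : ℤ) - 1 - 1 by ring]
  exact (adj_U_iff.2 (Or.inr (Or.inl rfl))).symm

/-- the two doors differ -/
theorem doors_ne (M : ℕ) : s(D (M : ℤ) 0, U (M : ℤ) 0) ≠ s(D (-(M : ℤ) - 2) 0, U (-(M : ℤ) - 1) 0) := by
  intro h
  rcases Sym2.eq_iff.1 h with ⟨h1, -⟩ | ⟨h1, -⟩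
  · have := congrFun (congrArg Prod.fst h1) 0
    simp [D] at this
    omega
  · have := congrArg Prod.snd h1
    simp [D, U] at this

/-- the east door `{D(M,0), U(M,0)}` straddles the circle of radius `N_M` -/
theorem straddles_east (M : ℕ) : Straddles (Λd M) 0 (NM M) s(D (M : ℤ) 0, U (M : ℤ) 0) := by
  refine ⟨D M 0, U M 0, rfl, (adj_U_D _ _).symm, D_not_mem_Λd M, U_mem_Λd M, ?_, ?_⟩
  · rw [dist_zero_right]; exact le_rfl
  · rw [dist_zero_right, NM_lt_norm_iff, cA_D, cB_D]; nlinarith [Int.natCast_nonneg M]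

/-- the west door `{D(-M-2,0), U(-M-1,0)}` straddles the circle of radius `N_M` -/
theorem straddles_west (M : ℕ) :
    Straddles (Λd M) 0 (NM M) s(D (-(M : ℤ) - 2) 0, U (-(M : ℤ) - 1) 0) := by
  refine ⟨D (-(M : ℤ) - 2) 0, U (-(M : ℤ) - 1) 0, rfl, adj_D'_U' M, D'_not_mem_Λd M, U'_mem_Λd M,
    ?_, ?_⟩
  · rw [dist_zero_right, norm_le_NM_iff, cA_U, cB_U]; nlinarith [Int.natCast_nonneg M]
  · rw [dist_zero_right, NM_lt_norm_iff, cA_D, cB_D]; nlinarith [Int.natCast_nonneg M]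

/-! ### the zigzag `U(t,0), D(t-1,0), U(t-1,0), …, U(t-n,0)` -/

/-- the zigzag of `2n+1` cells along the real axis from `U(t,0)` down to `U(t-n,0)` -/
def zig (t : ℤ) : ℕ → List HexVertex
  | 0 => [U t 0]
  | n + 1 => U t 0 :: D (t - 1) 0 :: zig (t - 1) n

/-- the zigzag is nonempty -/
theorem zig_ne_nil (t : ℤ) (n : ℕ) : zig t n ≠ [] := by cases n <;> simp [zig]

/-- first cell of the zigzag, `head?` form -/
theorem head?_zig (t : ℤ) (n : ℕ) : (zig t n).head? = some (U t 0) := by cases n <;> rfl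

/-- first cell of the zigzag -/
theorem head_zig (t : ℤ) (n : ℕ) : (zig t n).head (zig_ne_nil t n) = U t 0 := by cases n <;> rfl

/-- the zigzag `zig t n` has `2n+1` cells -/
theorem length_zig : ∀ (n : ℕ) (t : ℤ), (zig t n).length = 2 * n + 1
  | 0, _ => rfl
  | n + 1, t => by simp only [zig, List.length_cons, length_zig n]; omega

/-- last cell of the zigzag -/
theorem getLast_zig : ∀ (n : ℕ) (t : ℤ), (zig t n).getLast (zig_ne_nil t n) = U (t - n) 0
  | 0, t => by simp [zig]
  | n + 1, t => by
    have h := getLast_zig n (t - 1)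
    simp only [zig, List.getLast_cons_cons, List.getLast_cons (zig_ne_nil _ _)]
    rw [h]; congr 1; push_cast; ring

/-- the zigzag is a lattice chain -/
theorem isChain_zig : ∀ (n : ℕ) (t : ℤ), (zig t n).IsChain hexGraph.Adj
  | 0, t => List.isChain_singleton _
  | n + 1, t => by
    simp only [zig]
    refine List.isChain_cons_cons.2 ⟨adj_U_iff.2 (Or.inr (Or.inl rfl)), ?_⟩
    refine List.isChain_cons.2 ⟨?_, isChain_zig n (t - 1)⟩
    intro y hy
    rw [head?_zig] at hy
    simp only [Option.mem_def, Option.some.injEq] at hy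
    subst hy
    exact (adj_U_D _ _).symm

/-- the cells of the zigzag -/
theorem mem_zig : ∀ (n : ℕ) (t : ℤ) (v : HexVertex), v ∈ zig t n →
    (∃ m : ℕ, m ≤ n ∧ v = U (t - m) 0) ∨ (∃ m : ℕ, m < n ∧ v = D (t - 1 - m) 0)
  | 0, t, v, hv => by
    simp only [zig, List.mem_singleton] at hv
    exact Or.inl ⟨0, le_rfl, by simpa using hv⟩
  | n + 1, t, v, hv => by
    simp only [zig, List.mem_cons] at hv
    rcases hv with rfl | rfl | hv
    · exact Or.inl ⟨0, Nat.zero_le _, by simp⟩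
    · exact Or.inr ⟨0, Nat.succ_pos _, by simp⟩
    · rcases mem_zig n (t - 1) v hv with ⟨m, hm, rfl⟩ | ⟨m, hm, rfl⟩
      · exact Or.inl ⟨m + 1, by omega, by congr 1; push_cast; ring⟩
      · exact Or.inr ⟨m + 1, by omega, by congr 1; push_cast; ring⟩

/-- up and down faces differ -/
theorem U_ne_D (i j i' j' : ℤ) : U i j ≠ D i' j' := fun h => by
  have := congrArg Prod.snd h; simp [U, D] at this

/-- `U` is injective in the first index -/
theorem U_inj {i j i' j' : ℤ} (h : U i j = U i' j') : i = i' := by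
  have := congrFun (congrArg Prod.fst h) 0; simpa [U] using this

/-- `D` is injective in the first index -/
theorem D_inj {i j i' j' : ℤ} (h : D i j = D i' j') : i = i' := by
  have := congrFun (congrArg Prod.fst h) 0; simpa [D] using this

/-- the zigzag is duplicate-free -/
theorem nodup_zig : ∀ (n : ℕ) (t : ℤ), (zig t n).Nodup
  | 0, t => List.nodup_singleton _
  | n + 1, t => by
    simp only [zig, List.nodup_cons, List.mem_cons, not_or]
    refine ⟨⟨U_ne_D _ _ _ _, fun h => ?_⟩, fun h => ?_, nodup_zig n (t - 1)⟩
    · rcases mem_zig n (t - 1) _ h with ⟨m, -, hm⟩ | ⟨m, -, hm⟩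
      · have := U_inj hm; omega
      · exact U_ne_D _ _ _ _ hm
    · rcases mem_zig n (t - 1) _ h with ⟨m, -, hm⟩ | ⟨m, -, hm⟩
      · exact U_ne_D _ _ _ _ hm.symm
      · have := D_inj hm; omega

/-- the up faces on the zigzag -/
theorem U_mem_zig : ∀ (n : ℕ) (t : ℤ) (m : ℕ), m ≤ n → U (t - m) 0 ∈ zig t n
  | 0, t, m, hm => by
    have : m = 0 := Nat.le_zero.1 hm
    subst this; simp [zig]
  | n + 1, t, 0, _ => by simp [zig]
  | n + 1, t, m + 1, hm => by
    simp only [zig, List.mem_cons]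
    refine Or.inr (Or.inr ?_)
    have h := U_mem_zig n (t - 1) m (by omega)
    have e : t - 1 - (m : ℤ) = t - ((m + 1 : ℕ) : ℤ) := by push_cast; ring
    rwa [e] at h

/-- the cells of the zigzag `zig M (2M+1)` lie in the blocked disc `Λ_M` -/
theorem zig_subset (M : ℕ) : ∀ v ∈ zig M (2 * M + 1), v ∈ Λd M := by
  intro v hv
  rw [mem_Λd, norm_le_NM_iff]
  rcases mem_zig _ _ v hv with ⟨m, hm, rfl⟩ | ⟨m, hm, rfl⟩
  · rw [cA_U, cB_U]
    have hm' : (m : ℤ) ≤ 2 * M + 1 := by exact_mod_cast hm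
    nlinarith [mul_nonneg (Int.natCast_nonneg m) (by linarith : (0 : ℤ) ≤ 2 * M + 1 - m)]
  · rw [cA_D, cB_D]
    have hm' : (m : ℤ) ≤ 2 * M := by exact_mod_cast Nat.lt_succ_iff.1 hm
    nlinarith [mul_nonneg (Int.natCast_nonneg m) (by linarith : (0 : ℤ) ≤ 2 * M - m)]

/-- **the zigzag diver**: the straight arc through the centre between the two antipodal doors -/
def zigArc (M : ℕ) :
    HexMidEdgeSAW (Λd M) s(D (M : ℤ) 0, U (M : ℤ) 0) s(D (-(M : ℤ) - 2) 0, U (-(M : ℤ) - 1) 0) :=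
  mkArc (zig M (2 * M + 1)) (zig_ne_nil _ _) (nodup_zig _ _) (isChain_zig _ _) (zig_subset M)
    (D_not_mem_Λd M) (D'_not_mem_Λd M) (head_zig _ _)
    (by rw [getLast_zig]; congr 1; push_cast; ring) (adj_U_D _ _).symm (doors_ne M)

/-- the zigzag diver has `4M+3` cells -/
theorem zigArc_length (M : ℕ) : (zigArc M).length = 4 * M + 3 := by
  rw [HexMidEdgeSAW.length, zigArc, mkArc_verts, length_zig]; ring

/-- the zigzag diver dives: it visits `U(0,0)`, at distance `1/√3 ≤ N_M/2` for `M ≥ 1` -/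
theorem zigArc_dives (M : ℕ) (hM : 1 ≤ M) :
    ∃ v ∈ (zigArc M).verts, dist (hexCenter v) 0 ≤ NM M / 2 := by
  refine ⟨U 0 0, ?_, ?_⟩
  · rw [zigArc, mkArc_verts]
    have h := U_mem_zig (2 * M + 1) M M (by omega)
    rwa [sub_self] at h
  · rw [dist_le_half_iff, cA_U, cB_U]
    have : (1 : ℤ) ≤ M := by exact_mod_cast hM
    nlinarith


end

section

variable {x : ℝ}

/-! ## The refutation -/

/-- **dive mass from below**: the zigzag alone contributes `x^{4M+3}`. -/
theorem pow_le_diveMassAt (M : ℕ) (hM : 1 ≤ M) (hx : 0 ≤ x) :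
    x ^ (4 * M + 3) ≤ diveMassAt x hexGraph (Λd M) s(D (M : ℤ) 0, U (M : ℤ) 0)
      s(D (-(M : ℤ) - 2) 0, U (-(M : ℤ) - 1) 0) 0 (NM M / 2) := by
  unfold diveMassAt
  set f := fun γ : HexMidEdgeSAW (Λd M) s(D (M : ℤ) 0, U (M : ℤ) 0)
      s(D (-(M : ℤ) - 2) 0, U (-(M : ℤ) - 1) 0) =>
    if IsHArc hexGraph γ ∧ ∃ v ∈ γ.verts, dist (hexCenter v) 0 ≤ NM M / 2 then x ^ γ.length else 0
    with hf
  have hterm : f (zigArc M) = x ^ (4 * M + 3) := by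
    simp only [hf]
    rw [if_pos ⟨isChain_zig _ _, zigArc_dives M hM⟩, zigArc_length]
  rw [← hterm]
  exact Finset.single_le_sum (fun γ _ => by simp only [hf]; split_ifs <;> positivity)
    (Finset.mem_univ (zigArc M))

/-- **stay mass from above**: non-diving arcs have `≥ 5M+3` cells. -/
theorem stayMassAt_le (M : ℕ) (hx : 0 ≤ x) (h3x : 3 * x < 1) :
    stayMassAt x hexGraph (Λd M) s(D (M : ℤ) 0, U (M : ℤ) 0) s(D (-(M : ℤ) - 2) 0, U (-(M : ℤ) - 1) 0)
        0 (NM M / 2) ≤ (3 * x) ^ (5 * M + 3) / (1 - 3 * x) := by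
  refine le_trans (Finset.sum_le_sum fun γ _ => ?_)
    (sum_pow_length_ge_le (w' := s(D (-(M : ℤ) - 2) 0, U (-(M : ℤ) - 1) 0)) (D_not_mem_Λd M) hx h3x
      (5 * M + 3))
  by_cases hγ : IsHArc hexGraph γ ∧ ¬ ∃ v ∈ γ.verts, dist (hexCenter v) 0 ≤ NM M / 2
  · rw [if_pos hγ]
    have hne : γ.verts ≠ [] := fun h => doors_ne M (γ.eq_of_nil h)
    have hlen : 5 * M + 3 ≤ γ.length := by
      refine length_ge_of_far M γ.verts hne γ.isChain (head_eq_of_door (D_not_mem_Λd M) γ hne)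
        (getLast_eq_of_door (D'_not_mem_Λd M) γ hne) fun P hP hP0 => ?_
      have hfar : ¬ dist (hexCenter P) 0 ≤ NM M / 2 := fun h => hγ.2 ⟨P, hP, h⟩
      rw [dist_le_half_iff, hP0] at hfar
      have h0 : (0 : ℤ) ≤ cB P ^ 2 := sq_nonneg _
      generalize cB P ^ 2 = Y at hfar h0 ⊢
      nlinarith
    rw [if_pos hlen]
  · rw [if_neg hγ]
    split_ifs <;> positivity

/-- **`OneScaleDive` FAILS at small fugacity**: for `0 < x ≤ 1/500` there is no one-scale dive bound
`q < 1` — sub-critically the chord between antipodal doors concentrates on the diving geodesics. -/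
theorem not_oneScaleDiveAt_of_le (hx : 0 < x) (hx' : x ≤ 1 / 500) : ¬ OneScaleDiveAt x := by
  rintro ⟨q, hq0, hq1, N₀, h⟩
  have h1q : 0 < 1 - q := sub_pos.2 hq1
  obtain ⟨M₁, hM₁⟩ : ∃ M₁ : ℕ, (1 / 2 : ℝ) ^ M₁ < (1 - q) / (54 * q + 1) :=
    exists_pow_lt_of_lt_one (div_pos h1q (by positivity)) (by norm_num)
  set M : ℕ := M₁ + ⌈N₀⌉₊ + 1 with hM
  have hM1 : 1 ≤ M := by omega
  have hMN : N₀ ≤ NM M := by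
    have h1 : N₀ ≤ (⌈N₀⌉₊ : ℝ) := Nat.le_ceil N₀
    have h2 : ((⌈N₀⌉₊ : ℕ) : ℝ) ≤ (M : ℝ) := by exact_mod_cast (by omega : ⌈N₀⌉₊ ≤ M)
    linarith [half_le_NM M]
  have key := h hexGraph (Λd M) 0 (NM M) _ _ hMN (isVirgin_Λd M) (straddles_east M) (straddles_west M)
  rw [arcMassAt_eq_add x hexGraph (Λd M) _ _ 0 (NM M / 2)] at key
  have h3x : 3 * x < 1 := by linarith
  have hD := pow_le_diveMassAt M hM1 hx.le
  have hS := stayMassAt_le M hx.le h3x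
  set Dv := diveMassAt x hexGraph (Λd M) s(D (M : ℤ) 0, U (M : ℤ) 0)
    s(D (-(M : ℤ) - 2) 0, U (-(M : ℤ) - 1) 0) 0 (NM M / 2) with hDv
  set Sv := stayMassAt x hexGraph (Λd M) s(D (M : ℤ) 0, U (M : ℤ) 0)
    s(D (-(M : ℤ) - 2) 0, U (-(M : ℤ) - 1) 0) 0 (NM M / 2) with hSv
  -- (1 - q) x^{4M+3} ≤ q (3x)^{5M+3} / (1 - 3x)
  have hz : 0 < x ^ (4 * M + 3) := pow_pos hx _
  have step : (1 - q) * x ^ (4 * M + 3) ≤ q * ((3 * x) ^ (5 * M + 3) / (1 - 3 * x)) := by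
    have : (1 - q) * Dv ≤ q * Sv := by nlinarith
    nlinarith [mul_le_mul_of_nonneg_left hS hq0, mul_le_mul_of_nonneg_left hD h1q.le]
  -- rewrite the right-hand side as x^{4M+3} · 27 q (243x)^M / (1-3x)
  have e1 : (3 * x) ^ (5 * M + 3) = x ^ (4 * M + 3) * (27 * (243 * x) ^ M) := by
    have e2 : (3 : ℝ) ^ (5 * M + 3) = 27 * 243 ^ M := by
      rw [pow_add, pow_mul]; norm_num; ring
    have e3 : x ^ (5 * M + 3) = x ^ (4 * M + 3) * x ^ M := by
      rw [← pow_add]; congr 1; ring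
    rw [mul_pow, e2, e3, mul_pow]; ring
  rw [e1] at step
  have h13 : 1 / (1 - 3 * x) ≤ 2 := by
    rw [div_le_iff₀ (by linarith)]; linarith
  have h243 : (243 * x) ^ M ≤ (1 / 2) ^ M :=
    pow_le_pow_left₀ (by positivity) (by linarith) M
  have hhalf : (1 / 2 : ℝ) ^ M ≤ (1 / 2) ^ M₁ :=
    pow_le_pow_of_le_one (by norm_num) (by norm_num) (by omega)
  have hfin : 54 * q * ((1 - q) / (54 * q + 1)) < 1 - q := by
    rw [show 54 * q * ((1 - q) / (54 * q + 1)) = (1 - q) * (54 * q / (54 * q + 1)) by ring]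
    have : 54 * q / (54 * q + 1) < 1 := by
      rw [div_lt_one (by positivity)]; linarith
    nlinarith
  -- divide by x^{4M+3}
  have step2 : (1 - q) ≤ q * (27 * (243 * x) ^ M) / (1 - 3 * x) := by
    have h' : (1 - q) * x ^ (4 * M + 3) ≤ (q * (27 * (243 * x) ^ M) / (1 - 3 * x)) * x ^ (4 * M + 3) := by
      calc (1 - q) * x ^ (4 * M + 3) ≤ q * (x ^ (4 * M + 3) * (27 * (243 * x) ^ M) / (1 - 3 * x)) := step
        _ = (q * (27 * (243 * x) ^ M) / (1 - 3 * x)) * x ^ (4 * M + 3) := by ring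
    exact le_of_mul_le_mul_right h' hz
  have hpos27 : 0 ≤ q * (27 * (243 * x) ^ M) := by positivity
  have step3 : q * (27 * (243 * x) ^ M) / (1 - 3 * x) ≤ 2 * (q * (27 * (243 * x) ^ M)) := by
    rw [div_eq_mul_one_div]
    nlinarith
  have step4 : 2 * (q * (27 * (243 * x) ^ M)) ≤ 54 * q * (1 / 2) ^ M₁ := by
    nlinarith [mul_le_mul_of_nonneg_left (h243.trans hhalf) hq0]
  have step5 : 54 * q * (1 / 2 : ℝ) ^ M₁ ≤ 54 * q * ((1 - q) / (54 * q + 1)) :=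
    mul_le_mul_of_nonneg_left hM₁.le (by positivity)
  linarith


/-- **the milestone `BulkOneArmDecay` FAILS at small fugacity too** (its level `m = 1` is the dive bound). -/
theorem not_bulkOneArmDecayAt_of_le (hx : 0 < x) (hx' : x ≤ 1 / 500) : ¬ BulkOneArmDecayAt x :=
  fun h => not_oneScaleDiveAt_of_le hx hx' (oneScaleDiveAt_of_bulk h)

end

end Summit.CriticalPhenomena.SAWScalingLimit.Cruxes.HexTight.Negative.Subcritical

end
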